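import Summits.Ventures.PercRepro.S1CFGCrude

/-!
# PercRepro — THE `6`-SET COUNTS FROM THE `5`-SET COUNTS AT EVERY NULLITY (p1, gen 38)

The double count of S1CFGDouble at `k = 6`, for a coloop-free matroid of nullity `ν` with `s < rk E`:
* **`six_mul_ncard_six_eRk_le_one_le`** — `6 · Q₆¹ ≤ (ν − 5) · Q₅¹` (loopless);
* **`six_mul_ncard_six_eRk_le_two_le`** — `6 · Q₆² ≤ (ν − 4) · Q₅² + (n − 5) · Q₅¹`;
* **`six_mul_ncard_six_eRk_le_three_le`** — `6 · Q₆³ ≤ (ν − 3) · Q₅³ + (n − 5) · Q₅²`;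
* **`six_mul_ncard_six_eRk_le_four_le`** — `6 · Q₆⁴ ≤ (ν − 2) · Q₅⁴ + (n − 5) · Q₅³`;
* **`six_mul_ncard_six_eRk_le_five_le`** — `6 · Q₆⁵ ≤ (ν − 1) · C(n, 5) + (n − 5) · Q₅⁴`.
These are the counts of the nullity-`6` contractions of p7's regimes at `(13, 10)` (`k₀ = 6`): numerals in S1CFGSixValues.
Nothing about any cell is claimed. Axioms: standard.
-/

open scoped Matroid

namespace PercRepro

namespace S1CFG

open Set S1CF

variable {α : Type}

/-- **`6 · Q₆^2 ≤ (ν − 4) · Q₅^2 + (n − 5) · Q₅^1`** (coloop-free, nullity `ν`, `2 < rk E`). -/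
theorem six_mul_ncard_six_eRk_le_two_le (M : Matroid α) [M.Finite] (hK : ∀ e, ¬ M.IsColoop e) {ν : ℕ}
    (hd : M.E.encard = M.eRank + (ν : ℕ∞)) (hs : 2 < (M.eRk M.E).toNat) :
    6 * {X : Set α | X ⊆ M.E ∧ X.ncard = 6 ∧ M.eRk X ≤ 2}.ncard ≤
      (ν - 4) * {X : Set α | X ⊆ M.E ∧ X.ncard = 5 ∧ M.eRk X ≤ 2}.ncard +
        (M.E.ncard - 5) * {X : Set α | X ⊆ M.E ∧ X.ncard = 5 ∧ M.eRk X ≤ 1}.ncard := by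
  have hEfin := M.ground_finite
  have hdc := mul_ncard_le_of_eRk M hK hd (k := 6) (s := 2) (by norm_num) (by norm_num) hs
  have hex : {Y : Set α | Y ⊆ M.E ∧ Y.ncard = 6 - 1 ∧ M.eRk Y = 2}.ncard ≤
      {X : Set α | X ⊆ M.E ∧ X.ncard = 5 ∧ M.eRk X ≤ 2}.ncard := by
    refine Set.ncard_le_ncard ?_ (hEfin.finite_subsets.subset (fun X hX => hX.1))
    intro Y hY
    exact ⟨hY.1, by simpa using hY.2.1, le_of_eq hY.2.2⟩
  have hlow : {Y : Set α | Y ⊆ M.E ∧ Y.ncard = 6 - 1 ∧ M.eRk Y ≤ ((2 - 1 : ℕ) : ℕ∞)}.ncard =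
      {X : Set α | X ⊆ M.E ∧ X.ncard = 5 ∧ M.eRk X ≤ 1}.ncard := by
    congr 1
  rw [hlow, show 2 + ν - 6 = ν - 4 by omega] at hdc
  rw [show (6 : ℕ) - 1 = 5 by norm_num] at hdc hex
  exact hdc.trans (Nat.add_le_add_right (Nat.mul_le_mul_left _ hex) _)

/-- **`6 · Q₆^3 ≤ (ν − 3) · Q₅^3 + (n − 5) · Q₅^2`** (coloop-free, nullity `ν`, `3 < rk E`). -/
theorem six_mul_ncard_six_eRk_le_three_le (M : Matroid α) [M.Finite] (hK : ∀ e, ¬ M.IsColoop e) {ν : ℕ}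
    (hd : M.E.encard = M.eRank + (ν : ℕ∞)) (hs : 3 < (M.eRk M.E).toNat) :
    6 * {X : Set α | X ⊆ M.E ∧ X.ncard = 6 ∧ M.eRk X ≤ 3}.ncard ≤
      (ν - 3) * {X : Set α | X ⊆ M.E ∧ X.ncard = 5 ∧ M.eRk X ≤ 3}.ncard +
        (M.E.ncard - 5) * {X : Set α | X ⊆ M.E ∧ X.ncard = 5 ∧ M.eRk X ≤ 2}.ncard := by
  have hEfin := M.ground_finite
  have hdc := mul_ncard_le_of_eRk M hK hd (k := 6) (s := 3) (by norm_num) (by norm_num) hs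
  have hex : {Y : Set α | Y ⊆ M.E ∧ Y.ncard = 6 - 1 ∧ M.eRk Y = 3}.ncard ≤
      {X : Set α | X ⊆ M.E ∧ X.ncard = 5 ∧ M.eRk X ≤ 3}.ncard := by
    refine Set.ncard_le_ncard ?_ (hEfin.finite_subsets.subset (fun X hX => hX.1))
    intro Y hY
    exact ⟨hY.1, by simpa using hY.2.1, le_of_eq hY.2.2⟩
  have hlow : {Y : Set α | Y ⊆ M.E ∧ Y.ncard = 6 - 1 ∧ M.eRk Y ≤ ((3 - 1 : ℕ) : ℕ∞)}.ncard =
      {X : Set α | X ⊆ M.E ∧ X.ncard = 5 ∧ M.eRk X ≤ 2}.ncard := by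
    congr 1
  rw [hlow, show 3 + ν - 6 = ν - 3 by omega] at hdc
  rw [show (6 : ℕ) - 1 = 5 by norm_num] at hdc hex
  exact hdc.trans (Nat.add_le_add_right (Nat.mul_le_mul_left _ hex) _)

/-- **`6 · Q₆^4 ≤ (ν − 2) · Q₅^4 + (n − 5) · Q₅^3`** (coloop-free, nullity `ν`, `4 < rk E`). -/
theorem six_mul_ncard_six_eRk_le_four_le (M : Matroid α) [M.Finite] (hK : ∀ e, ¬ M.IsColoop e) {ν : ℕ}
    (hd : M.E.encard = M.eRank + (ν : ℕ∞)) (hs : 4 < (M.eRk M.E).toNat) :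
    6 * {X : Set α | X ⊆ M.E ∧ X.ncard = 6 ∧ M.eRk X ≤ 4}.ncard ≤
      (ν - 2) * {X : Set α | X ⊆ M.E ∧ X.ncard = 5 ∧ M.eRk X ≤ 4}.ncard +
        (M.E.ncard - 5) * {X : Set α | X ⊆ M.E ∧ X.ncard = 5 ∧ M.eRk X ≤ 3}.ncard := by
  have hEfin := M.ground_finite
  have hdc := mul_ncard_le_of_eRk M hK hd (k := 6) (s := 4) (by norm_num) (by norm_num) hs
  have hex : {Y : Set α | Y ⊆ M.E ∧ Y.ncard = 6 - 1 ∧ M.eRk Y = 4}.ncard ≤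
      {X : Set α | X ⊆ M.E ∧ X.ncard = 5 ∧ M.eRk X ≤ 4}.ncard := by
    refine Set.ncard_le_ncard ?_ (hEfin.finite_subsets.subset (fun X hX => hX.1))
    intro Y hY
    exact ⟨hY.1, by simpa using hY.2.1, le_of_eq hY.2.2⟩
  have hlow : {Y : Set α | Y ⊆ M.E ∧ Y.ncard = 6 - 1 ∧ M.eRk Y ≤ ((4 - 1 : ℕ) : ℕ∞)}.ncard =
      {X : Set α | X ⊆ M.E ∧ X.ncard = 5 ∧ M.eRk X ≤ 3}.ncard := by
    congr 1
  rw [hlow, show 4 + ν - 6 = ν - 2 by omega] at hdc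
  rw [show (6 : ℕ) - 1 = 5 by norm_num] at hdc hex
  exact hdc.trans (Nat.add_le_add_right (Nat.mul_le_mul_left _ hex) _)

/-- **`6 · Q₆^5 ≤ (ν − 1) · C(n, 5) + (n − 5) · Q₅^4`** (coloop-free, nullity `ν`, `5 < rk E`). -/
theorem six_mul_ncard_six_eRk_le_five_le (M : Matroid α) [M.Finite] (hK : ∀ e, ¬ M.IsColoop e) {ν : ℕ}
    (hd : M.E.encard = M.eRank + (ν : ℕ∞)) (hs : 5 < (M.eRk M.E).toNat) :
    6 * {X : Set α | X ⊆ M.E ∧ X.ncard = 6 ∧ M.eRk X ≤ 5}.ncard ≤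
      (ν - 1) * M.E.ncard.choose 5 +
        (M.E.ncard - 5) * {X : Set α | X ⊆ M.E ∧ X.ncard = 5 ∧ M.eRk X ≤ 4}.ncard := by
  have hEfin := M.ground_finite
  have hdc := mul_ncard_le_of_eRk M hK hd (k := 6) (s := 5) (by norm_num) (by norm_num) hs
  have hex : {Y : Set α | Y ⊆ M.E ∧ Y.ncard = 6 - 1 ∧ M.eRk Y = 5}.ncard ≤ M.E.ncard.choose 5 := by
    rw [← ncard_subsets_eq_choose hEfin 5]
    refine Set.ncard_le_ncard ?_ (hEfin.finite_subsets.subset (fun X hX => hX.1))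
    intro Y hY
    exact ⟨hY.1, by simpa using hY.2.1⟩
  have hlow : {Y : Set α | Y ⊆ M.E ∧ Y.ncard = 6 - 1 ∧ M.eRk Y ≤ ((5 - 1 : ℕ) : ℕ∞)}.ncard =
      {X : Set α | X ⊆ M.E ∧ X.ncard = 5 ∧ M.eRk X ≤ 4}.ncard := by
    congr 1
  rw [hlow, show 5 + ν - 6 = ν - 1 by omega] at hdc
  rw [show (6 : ℕ) - 1 = 5 by norm_num] at hdc
  exact hdc.trans (Nat.add_le_add_right (Nat.mul_le_mul_left _ hex) _)

/-- **`6 · Q₆¹ ≤ (ν − 5) · Q₅¹`** (loopless, coloop-free, nullity `ν`, `1 < rk E`). -/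
theorem six_mul_ncard_six_eRk_le_one_le (M : Matroid α) [M.Finite] (hL : ∀ e ∈ M.E, ¬ M.IsLoop e)
    (hK : ∀ e, ¬ M.IsColoop e) {ν : ℕ} (hd : M.E.encard = M.eRank + (ν : ℕ∞)) (hs : 1 < (M.eRk M.E).toNat) :
    6 * {X : Set α | X ⊆ M.E ∧ X.ncard = 6 ∧ M.eRk X ≤ 1}.ncard ≤
      (ν - 5) * {X : Set α | X ⊆ M.E ∧ X.ncard = 5 ∧ M.eRk X ≤ 1}.ncard := by
  have hEfin := M.ground_finite
  have hdc := mul_ncard_le_of_eRk M hK hd (k := 6) (s := 1) (by norm_num) (by norm_num) hs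
  have h0 := ncard_eRk_le_zero_eq_zero M hL (k := 6 - 1) (by norm_num)
  rw [show (1 : ℕ) - 1 = 0 by norm_num, h0, mul_zero, add_zero, show 1 + ν - 6 = ν - 5 by omega] at hdc
  have hex : {Y : Set α | Y ⊆ M.E ∧ Y.ncard = 6 - 1 ∧ M.eRk Y = 1}.ncard ≤
      {X : Set α | X ⊆ M.E ∧ X.ncard = 5 ∧ M.eRk X ≤ 1}.ncard := by
    refine Set.ncard_le_ncard ?_ (hEfin.finite_subsets.subset (fun X hX => hX.1))
    intro Y hY
    exact ⟨hY.1, by simpa using hY.2.1, le_of_eq hY.2.2⟩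
  exact hdc.trans (Nat.mul_le_mul_left _ hex)

end S1CFG

end PercRepro
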